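import Summits.Ventures.HodgeRepro2.T5FinitePlaceFourSquares

/-!
# `⟨1, 1, 1⟩` is isotropic over `E_w` at EVERY finite non-split place: `(U)` with no binder anywhere
(cell pub-hodge-repro2, seat p3)

Tier-5 N2 support, rows N2.2.2 / N2.8.1 of route/T5-N2-route-3.md. File 148 reduced `(U)` at every finite
non-split place to ONE statement, «`−1` is a sum of two norms from `L_w`»; file 149 proved it when `−θ` is a
`v`-adic square. Here it is proved at EVERY finite non-split place, with no hypothesis on `θ` and no dyadic
restriction, from the index-two structure of the norm group (seat p4's `T5LocalNormIndex.index_normGroup_eq_two`,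
through file 141) and «`−1` is a sum of squares in `Kᵥ`» (file 149's four squares at a dyadic place; file 142's
`(U′)` at a non-dyadic one):

* `isSumTwoNorms_neg_one_of_step`: if `s = N(t)` is a norm or zero, `x ∈ Kᵥ`, and `x² + s` is neither a norm
  nor zero, while `−1` is not a norm, then `−(x² + s) = N(z)` (the product of two non-norms is a norm) with
  `z ≠ 0`, so `N(z) + N(t) + N(x) = 0` and `−1 = N(t/z) + N(x/z)`;
* `isSumTwoNorms_neg_one_of_isSumSq`: when `−1` is a sum of squares in `Kᵥ` (Mathlib's inductive `IsSumSq`),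
  the partial sums walk from `0 ∈ N ∪ {0}` to `−1`; either `−1 ∈ N` (then `−1 = N(z) + N(0)`) or some step
  leaves `N ∪ {0}` and the previous lemma applies;
* **`isSumTwoNorms_neg_one`**: `−1` is a sum of two norms at EVERY finite non-split place (`[L_w : Kᵥ] = 2`,
  `σ ≠ 1`): dyadic places by file 149's four squares, non-dyadic ones by file 142;
* `isSumTwoNorms_all`: `(U′)` for every `y ∈ Kᵥ` at every finite non-split place;
* **`exists_star_mul_self_add_eq_neg_one`** / **`binaryUniversal_of_nonsplit`**: `−1 = star x · x + star y · y`
  on the route's `E_w` (file 119's star), hence `(U)` at EVERY finite non-split place of `F`, and with it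
  Shimura's Lemma 1.6 (`isCongruent_iff_exists_det_eq_local_of_nonsplit`), row N2.8.1 (i)'s Hilbert-symbol
  criterion (`isCongruent_iff_hilbertSolvable_local_of_nonsplit`) and HKS96's «precisely two classes in each
  dimension» (`exists_two_classes_local_of_nonsplit`) UNCONDITIONALLY.

O'Meara 63:19 / Jacobowitz 1962 reach the isotropy of `⟨1, 1, 1⟩` through the quinary quadratic form
`⟨1, 1, 1, −θ, −θ⟩`; here the index-two structure of the norm group together with «`−1` is a sum of squares»
replaces the dyadic unit-form theory. Mathlib + this seat's files 141–149 and seat p4's chain through them only;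
no display; no device. §8(d): uses an L-value-free non-vanishing device: NO.
-/

namespace Summit.Ventures.HodgeRepro2.T5FinitePlaceIsotropy

open IsDedekindDomain IsDedekindDomain.HeightOneSpectrum NumberField Module
open Summit.Ventures.HodgeRepro2.T5FinitePlaceTensorEquiv Summit.Ventures.HodgeRepro2.T5FinitePlaceStar
  Summit.Ventures.HodgeRepro2.T5FinitePlaceIsometryCriterion Summit.Ventures.HodgeRepro2.T5HilbertSymbolNorm
  Summit.Ventures.HodgeRepro2.T5HermitianDetClass Summit.Ventures.HodgeRepro2.T5HermitianClassify
  Summit.Ventures.HodgeRepro2.T5HermitianTwoClasses Summit.Ventures.HodgeRepro2.T5AdicCompletionNormGroup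
  Summit.Ventures.HodgeRepro2.T5LocalNormIndex Summit.Ventures.HodgeRepro2.T5FinitePlaceNormIndex
  Summit.Ventures.HodgeRepro2.T5FinitePlaceSumTwoNorms Summit.Ventures.HodgeRepro2.T5FinitePlaceNegOneSum
  Summit.Ventures.HodgeRepro2.T5FinitePlaceFourSquares

/-! As in files 141–149, the namespace `T5FinitePlaceLiesOver` is not opened: `algebraMap (v.adicCompletion F)
(w.adicCompletion E)` is seat p4's global instance throughout. -/

section Local

variable {K : Type*} [Field K] [NumberField K] (v : HeightOneSpectrum (NumberField.RingOfIntegers K))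
  {L : Type*} [Field L] [NumberField L] [Algebra K L]
  (w : HeightOneSpectrum (NumberField.RingOfIntegers L)) [w.asIdeal.LiesOver v.asIdeal]
  (σ : Gal(adicCompletion L w/adicCompletion K v))
  (h2 : Module.finrank (adicCompletion K v) (adicCompletion L w) = 2) (hσ : σ ≠ 1)

include h2 hσ in
/-- **The step.** If `s = t σ t` is a norm or zero, `x ∈ Kᵥ`, and `x² + s` is neither a norm nor zero, while
`−1` is not a norm, then `−(x² + s) = z σ z` with `z ≠ 0` (the product of two non-norms is a norm, the index
being two), so `N(z) + N(t) + N(x) = 0` and `−1 = N(t/z) + N(x/z)`. -/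
theorem isSumTwoNorms_neg_one_of_step (hN : (-1 : (adicCompletion K v)ˣ) ∉ normGroup v w σ)
    {s : adicCompletion K v}
    (hs : ∃ t : adicCompletion L w, t * σ t = algebraMap (adicCompletion K v) (adicCompletion L w) s)
    (x : adicCompletion K v)
    (hsx : ¬ ∃ t : adicCompletion L w,
      t * σ t = algebraMap (adicCompletion K v) (adicCompletion L w) (x * x + s)) :
    IsSumTwoNorms v w σ (-1) := by
  -- `x² + s ≠ 0`, zero being `0 σ 0`
  have hne : x * x + s ≠ 0 := by
    intro h
    exact hsx ⟨0, by rw [h, map_zero, map_zero, mul_zero]⟩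
  -- the unit `x² + s` is not a norm
  have hu : Units.mk0 (x * x + s) hne ∉ normGroup v w σ := by
    intro h
    obtain ⟨t, ht⟩ := (mem_normGroup_iff v w σ _).1 h
    exact hsx ⟨t, by rw [ht, Units.val_mk0]⟩
  have hidx := index_normGroup_eq_two v w σ h2 hσ
  have hmem : Units.mk0 (x * x + s) hne * (-1) ∈ normGroup v w σ :=
    (Subgroup.mul_mem_iff_of_index_two hidx).2 (iff_of_false hu hN)
  obtain ⟨z, hz⟩ := (mem_normGroup_iff v w σ _).1 hmem
  have hval : ((Units.mk0 (x * x + s) hne * (-1) : (adicCompletion K v)ˣ) : adicCompletion K v) =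
      -(x * x + s) := by
    rw [Units.val_mul, Units.val_mk0, Units.val_neg, Units.val_one, mul_neg_one]
  rw [hval] at hz
  have hz0 : z ≠ 0 := by
    rintro rfl
    rw [map_zero, zero_mul, eq_comm, map_eq_zero, neg_eq_zero] at hz
    exact hne hz
  have hσz : σ z ≠ 0 := fun h => hz0 (σ.injective (by rw [h, map_zero]))
  obtain ⟨t, ht⟩ := hs
  refine ⟨t * z⁻¹, algebraMap (adicCompletion K v) (adicCompletion L w) x * z⁻¹, ?_⟩
  rw [map_mul σ, map_mul σ, map_inv₀ σ, σ.commutes]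
  have key : t * z⁻¹ * (σ t * (σ z)⁻¹) +
      algebraMap (adicCompletion K v) (adicCompletion L w) x * z⁻¹ *
        (algebraMap (adicCompletion K v) (adicCompletion L w) x * (σ z)⁻¹) =
      (t * σ t + algebraMap (adicCompletion K v) (adicCompletion L w) x *
        algebraMap (adicCompletion K v) (adicCompletion L w) x) * (z * σ z)⁻¹ := by
    rw [mul_inv]
    ring
  rw [key, ht, hz, ← map_mul (algebraMap (adicCompletion K v) (adicCompletion L w)),
    ← map_add (algebraMap (adicCompletion K v) (adicCompletion L w)),
    ← map_inv₀ (algebraMap (adicCompletion K v) (adicCompletion L w)),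
    ← map_mul (algebraMap (adicCompletion K v) (adicCompletion L w))]
  congr 1
  rw [add_comm s, inv_neg, mul_neg, mul_inv_cancel₀ hne]

include h2 hσ in
/-- **`−1` is a sum of two norms whenever it is a sum of squares in `Kᵥ`.** Either `−1` is a norm, or the partial
sums of the squares walk from `0 ∈ N ∪ {0}` to `−1 ∉ N ∪ {0}` and some step `s ↦ x² + s` leaves `N ∪ {0}`. -/
theorem isSumTwoNorms_neg_one_of_isSumSq (hsq : IsSumSq (-1 : adicCompletion K v)) :
    IsSumTwoNorms v w σ (-1) := by
  by_cases hN : (-1 : (adicCompletion K v)ˣ) ∈ normGroup v w σ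
  · simpa using isSumTwoNorms_of_mem v w σ hN
  have key : ∀ {s : adicCompletion K v}, IsSumSq s →
      (∃ t : adicCompletion L w, t * σ t = algebraMap (adicCompletion K v) (adicCompletion L w) s) ∨
        IsSumTwoNorms v w σ (-1) := by
    intro s hs
    induction hs with
    | zero => exact Or.inl ⟨0, by rw [map_zero, zero_mul, map_zero]⟩
    | sq_add a hs ih =>
      rcases ih with ih | ih
      · exact (em _).imp id fun h => isSumTwoNorms_neg_one_of_step v w σ h2 hσ hN ih a h
      · exact Or.inr ih
  rcases key hsq with h | h
  · exact absurd ((mem_normGroup_iff v w σ (-1)).2 (by simpa using h)) hN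
  · exact h

include h2 hσ in
/-- **`−1` is a sum of two norms from `L_w` at EVERY finite non-split place** (`[L_w : Kᵥ] = 2`, `σ ≠ 1`):
at a dyadic place `−1` is a sum of four squares of `Kᵥ` (file 149), at a non-dyadic one file 142's `(U′)`
applies directly. -/
theorem isSumTwoNorms_neg_one : IsSumTwoNorms v w σ (-1) := by
  by_cases h2u : IsUnit (2 : adicCompletionIntegers K v)
  · simpa using isSumTwoNorms v w σ h2 hσ h2u (-1)
  · obtain ⟨a, b, c, d, habcd⟩ := neg_one_eq_sum_four_sq v h2u
    refine isSumTwoNorms_neg_one_of_isSumSq v w σ h2 hσ ?_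
    rw [← habcd, sq, sq, sq, sq]
    exact ((IsSumSq.mul_self a).add (IsSumSq.mul_self b)).add (IsSumSq.mul_self c) |>.add (IsSumSq.mul_self d)

include h2 hσ in
/-- **`(U′)` at EVERY finite non-split place:** every `y ∈ Kᵥ` is a sum of two norms from `L_w`. -/
theorem isSumTwoNorms_all (y : adicCompletion K v) : IsSumTwoNorms v w σ y := by
  by_cases hy : y = 0
  · rw [hy]
    exact isSumTwoNorms_zero v w σ
  · exact isSumTwoNorms_of_neg_one v w σ h2 hσ (isSumTwoNorms_neg_one v w σ h2 hσ) (Units.mk0 y hy)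

end Local

section Universal

variable {F E : Type*} [Field F] [NumberField F] [Field E] [NumberField E] [Algebra F E]
  [Algebra.IsQuadraticExtension F E]
variable (v : HeightOneSpectrum (𝓞 F)) (w : HeightOneSpectrum (𝓞 E)) [w.asIdeal.LiesOver v.asIdeal]
variable {s : E} {θ : F}
variable (hs : s ^ 2 = algebraMap F E θ) (hspan : Submodule.span F {(1 : E), s} = ⊤)
  (hsq : ¬ IsSquare (algebraMap F (v.adicCompletion F) θ)) (c : E ≃ₐ[F] E) (hc : c s = -s)

/-- **`⟨1, 1, 1⟩` is isotropic over `E_w` at EVERY finite non-split place:** `−1 = star x · x + star y · y` for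
some `x, y ∈ E_w` (file 119's star = file 141's `localConj`). -/
theorem exists_star_mul_self_add_eq_neg_one :
    letI := localStarRing v w hs hspan hsq c hc
    ∃ x y : w.adicCompletion E, star x * x + star y * y = -1 := by
  letI := localStarRing v w hs hspan hsq c hc
  obtain ⟨x, y, hxy⟩ := isSumTwoNorms_neg_one v w (localConj v w hs hspan hsq c)
    (finrank_eq_two' v w hs hspan hsq) (localConj_ne_one v w hs hspan hsq c hc)
  refine ⟨x, y, ?_⟩
  rw [map_neg, map_one] at hxy
  rw [← hxy, localConj_eq_star v w hs hspan hsq c hc, localConj_eq_star v w hs hspan hsq c hc, mul_comm x,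
    mul_comm y]

/-- **`(U)` on the route's `E_w` at EVERY finite non-split place of `F`:** every binary diagonal hermitian form
`⟨a, b⟩` with `a, b ∈ F_v^×` represents every `c ∈ F_v^×` — no dyadic restriction, no hypothesis on `θ`. -/
theorem binaryUniversal_of_nonsplit :
    letI := localStarRing v w hs hspan hsq c hc
    BinaryUniversal (w.adicCompletion E) :=
  binaryUniversal_of_neg_one_sum v w hs hspan hsq c hc (exists_star_mul_self_add_eq_neg_one v w hs hspan hsq c hc)

/-- **Shimura's Lemma 1.6 on `E_w`, unconditional at EVERY finite non-split place** (Doc. Math. 13 p. 745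
ll. 22–23): two invertible hermitian matrices of the same size over `E_w` are congruent iff their determinants
differ by a norm `star u · u`. -/
theorem isCongruent_iff_exists_det_eq_local_of_nonsplit {ι : Type*} [Fintype ι] [DecidableEq ι]
    {H H' : Matrix ι ι (w.adicCompletion E)}
    (hH : letI := localStarRing v w hs hspan hsq c hc; H.IsHermitian)
    (hH' : letI := localStarRing v w hs hspan hsq c hc; H'.IsHermitian) (hdet : IsUnit H.det) :
    letI := localStarRing v w hs hspan hsq c hc
    IsCongruent H H' ↔ ∃ u : w.adicCompletion E, u ≠ 0 ∧ H'.det = star u * u * H.det := by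
  letI := localStarRing v w hs hspan hsq c hc
  exact isCongruent_iff_exists_det_eq (exists_add_star_ne_zero_local v w hs hspan hsq c hc)
    (binaryUniversal_of_nonsplit v w hs hspan hsq c hc) hH hH' hdet

/-- **Row N2.8.1 (i) on the route's completions, unconditional at EVERY finite non-split place:** Gram matrices
over `E_w` with `det H' = a · det H`, `a ∈ F_v^×`, are congruent iff `(a, θ)_v = 1` (O'Meara 63:1's equation
`a ξ² + θ η² = 1` solvable in `F_v`). -/
theorem isCongruent_iff_hilbertSolvable_local_of_nonsplit {ι : Type*} [Fintype ι] [DecidableEq ι]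
    {H H' : Matrix ι ι (w.adicCompletion E)}
    (hH : letI := localStarRing v w hs hspan hsq c hc; H.IsHermitian)
    (hH' : letI := localStarRing v w hs hspan hsq c hc; H'.IsHermitian) (hdet : IsUnit H.det)
    {a : v.adicCompletion F} (ha : a ≠ 0)
    (hdet' : H'.det = algebraMap (v.adicCompletion F) (w.adicCompletion E) a * H.det) :
    letI := localStarRing v w hs hspan hsq c hc
    IsCongruent H H' ↔ HilbertSolvable a (algebraMap F (v.adicCompletion F) θ) := by
  letI := localStarRing v w hs hspan hsq c hc
  have hdet'' : H'.det = T5FinitePlaceLiesOver.completionMap F E v w a * H.det := by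
    rw [hdet', algebraMap_apply']
  exact isCongruent_iff_hilbertSolvable v w hs hspan hsq c hc (binaryUniversal_of_nonsplit v w hs hspan hsq c hc)
    hH hH' hdet ha hdet''

/-- **HKS96's «precisely two isomorphism classes in each dimension» on `E_w`, unconditional at EVERY finite
non-split place:** for every `m`, two invertible hermitian `(m+1) × (m+1)` matrices over `E_w`, not congruent,
such that every invertible hermitian matrix is congruent to one of them. -/
theorem exists_two_classes_local_of_nonsplit (m : ℕ) :
    letI := localStarRing v w hs hspan hsq c hc
    ∃ H₁ H₂ : Matrix (Fin (m + 1)) (Fin (m + 1)) (w.adicCompletion E),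
      H₁.IsHermitian ∧ H₂.IsHermitian ∧ IsUnit H₁.det ∧ IsUnit H₂.det ∧ ¬ IsCongruent H₁ H₂ ∧
        ∀ H : Matrix (Fin (m + 1)) (Fin (m + 1)) (w.adicCompletion E), H.IsHermitian → IsUnit H.det →
          IsCongruent H H₁ ∨ IsCongruent H H₂ := by
  letI := localStarRing v w hs hspan hsq c hc
  exact exists_two_classes_local v w hs hspan hsq c hc (binaryUniversal_of_nonsplit v w hs hspan hsq c hc) m

end Universal

end Summit.Ventures.HodgeRepro2.T5FinitePlaceIsotropy
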